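import Mathlib
import Summits.Ventures.HSemireg.LineLawPrincipalGenus

/-!
# LINE LAW — the GENERAL CAPTURE for `m ≡ 1 (mod 4)`: even and ramified weights under one class per genus (ENGINE-W code B, #B22)

THEOREM A ∕ A′ of the LINE LAW (card LINE-LAW-B.md §7 ∕ §10, consolidated text LINE-LAW-THEOREMS-B.md §2–§3): over an order
`ℤ[√m]` with ONE CLASS PER GENUS (discriminant `4m`), every weight whose quotient `n = T∕c` is the norm of a primitive element is
CAPTURED — some primitive `z` with `N z = n` divides the given `A − √m`.  Kernel so far: `LineLawPrincipalGenus.capture` (k = 315)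
for `n` prime to `4m` (genus read off the value `n`), `LineLawRamifiedCapture.capture_ramified` (k = 331) for ramified odd parts;
NOT kernel: the EVEN weights of the conductor-2 case `m ≡ 1 (mod 4)` (THEOREM A′ — the hand proof goes through the maximal order;
LINE-LAW-THEOREMS-B.md §8 (i)).  This file proves ONE theorem covering all of them for `m ≡ 1 (mod 4)`, `m < 0` squarefree:
* `capture_one_mod_four_of_forall_genus` ∕ `capture_one_mod_four` — if `n = x² − m y² > 0` (`x, y` coprime), `A² − n k = m` and the
  form `(n, 2A, k)` is primitive (on a reached line this is LEMMA P, #B16; for squarefree `m` it says exactly «`n` or `k` odd» —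
  `lineForm_primitive_of_squarefree` — i.e. for even `n` the 2-ADIC RULE «`k` odd», whence `capture_one_mod_four_of_parity`),
  then under one class per genus for `4m` (`h(4m) = 2^{μ−1}`) some primitive `z ∈ ℤ√m` with `N z = n` divides `A − √m`.
  No parity or coprimality hypothesis on `n`.
The point: for `m ≡ 1 (mod 4)` the assigned characters of `4m` are the `χ_q`, `q ∣ m` odd, ONLY (`assignedChars_four_mul`; Cox's
table, `|4m|∕4 = −m ≡ 3 (mod 4)`), and at ANY value `v` of the form prime to `4m` (one exists: Cox Lemma 2.25, tree
`BinQF.exists_eval_isCoprime`) every `χ_q(v) = +1` by a two-line congruence (`isSquare_value`: `v·n = a² − m b²` and `n = x² − m y²`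
give `v ≡ (a∕x)²` if `q ∤ n` and `v ≡ (b∕y)²` if `q ∣ n`, using `m` squarefree) — so the form lies in the principal genus
(`mem_principalValues_iff_completeChar_eq_one`, tree), is properly equivalent to the principal form, its ideal `𝔞_n(A)` is principal
(Cox Thm 7.7, tree), and the §11 PROPOSITION (315) yields `z`.  This makes THEOREM A′ kernel for EVERY weight (odd or even) of the
nine conductor-2 census fields and all imaginary `m ≡ 1 (mod 4)` with one class per genus, modulo nothing but THEOREM CF⁶ by value.
Honest framing: form ∕ ideal arithmetic for `ℤ√m` only; Mukai vectors and lattices elsewhere, not objects; nothing here says that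
HC, HC_CM or HC_AV holds.
-/

open scoped nonZeroDivisors

namespace Summit.Ventures.HSemireg.LineLawGeneralCapture

open Zsqrtd
open Literature.NumberTheory.QuadraticFields (BinaryQuadraticForm.classNumber)
open Literature.NumberTheory.QuadraticFields.BinaryQuadraticForm (assignedCharCount)
open Literature.NumberTheory.QuadraticFields.Quadratic
open Literature.NumberTheory.QuadraticFields.Quadratic.GaussChar
open Literature.Computability.Cryptography.Hallgren2005.OrderCl (NegDiscr)
open Literature.Computability.Cryptography.Hallgren2005.FormComposition (one isPosPrim_one)
open Summit.Ventures.HSemireg.LineLawPrincipalGenus (dvd_and_norm_of_span_eq isCoprime_of_dvd ideal_lineForm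
  one_four_mul_eq_principalForm exists_span_singleton_of_coe_isPrincipal)

/-- The form `(n, 2A, k)` with `A² − n k = m`, `n > 0`, primitive (every common divisor of `n, 2A, k` a unit) is a primitive
positive definite form of discriminant `4m`.  (Generalises `LineLawPrincipalGenus.lineForm_isPosPrim`, which derived
primitivity from `gcd(n, 4m) = 1`.) -/
theorem lineForm_isPosPrim_of_primitive {m n k A : ℤ} (hn : 0 < n) (hk : A ^ 2 - n * k = m)
    (hprim : ∀ d : ℤ, d ∣ n → d ∣ 2 * A → d ∣ k → IsUnit d) : (⟨n, 2 * A, k⟩ : BinQF).IsPosPrim (4 * m) :=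
  ⟨by simp only [BinQF.disc]; linear_combination 4 * hk, hn, (BinQF.isPrimitive_iff _).2 hprim⟩

/-- **For squarefree `m` the form `(n, 2A, k)` (`A² − n k = m`) is primitive as soon as `n` or `k` is odd** — i.e. primitivity IS
the 2-ADIC RULE: an odd prime dividing `n, 2A, k` divides `A`, so its square divides `A² − n k = m`; the prime `2` is excluded by
the odd one of `n, k`. -/
theorem lineForm_primitive_of_squarefree {m n k A : ℤ} (hsq : Squarefree m) (hk : A ^ 2 - n * k = m)
    (h2 : Odd n ∨ Odd k) (d : ℤ) (hdn : d ∣ n) (hdA : d ∣ 2 * A) (hdk : d ∣ k) : IsUnit d := by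
  by_contra hd
  obtain ⟨p, hp, hpd⟩ := Int.exists_prime_and_dvd (mt Int.isUnit_iff_natAbs_eq.2 hd)
  have hpn := hpd.trans hdn
  have hpA := hpd.trans hdA
  have hpk := hpd.trans hdk
  by_cases hA : p ∣ A
  · have hpm : p * p ∣ m := by
      rw [← hk, sq]
      exact dvd_sub (mul_dvd_mul hA hA) (mul_dvd_mul hpn hpk)
    exact hp.not_unit (hsq p hpm)
  · have h2p : p ∣ 2 := (hp.dvd_or_dvd hpA).resolve_right hA
    have key : ∀ t : ℤ, Odd t → p ∣ t → False := by
      rintro t ⟨s, rfl⟩ ht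
      have h1 : p ∣ (2 * s + 1) - 2 * s := dvd_sub ht (dvd_mul_of_dvd_left h2p s)
      rw [show (2 * s + 1) - 2 * s = (1 : ℤ) by ring] at h1
      exact hp.not_unit (isUnit_of_dvd_one h1)
    rcases h2 with h | h
    · exact key n h hpn
    · exact key k h hpk

/-- **The character computation.**  Let `q` be a prime dividing the squarefree `m`, let `n = x² − m y²` with `x, y` coprime, and
let `v n = a² − m b²` with `q ∤ v`.  Then `v` is a nonzero square modulo `q`: if `q ∤ n` then `n ≡ x²`, `v n ≡ a²`, so
`v ≡ (a∕x)²`; if `q ∣ n` then `q ∣ x`, `q ∣ a`, and dividing `n` and `v n` by `q` once gives `n∕q ≡ −(m∕q) y²`,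
`v·(n∕q) ≡ −(m∕q) b²`, so `v y² ≡ b²` and `v ≡ (b∕y)²` (`q ∤ m∕q`, `q ∤ y`). -/
theorem isSquare_value {m n v x y a b : ℤ} {q : ℕ} [hq : Fact q.Prime] (hsq : Squarefree m) (hqm : (q : ℤ) ∣ m)
    (hrep : x ^ 2 - m * y ^ 2 = n) (hxy : IsCoprime x y) (hvn : v * n = a ^ 2 - m * b ^ 2) (hqv : ¬ (q : ℤ) ∣ v) :
    IsSquare (v : ZMod q) ∧ (v : ZMod q) ≠ 0 := by
  have hqZ : Prime (q : ℤ) := Nat.prime_iff_prime_int.1 hq.out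
  have hv0 : (v : ZMod q) ≠ 0 := fun h => hqv ((ZMod.intCast_zmod_eq_zero_iff_dvd v q).1 h)
  refine ⟨?_, hv0⟩
  have hm0 : ((m : ℤ) : ZMod q) = 0 := (ZMod.intCast_zmod_eq_zero_iff_dvd m q).2 hqm
  have hq0c : ((q : ℤ) : ZMod q) = 0 := by simp
  by_cases hqn : (q : ℤ) ∣ n
  · -- `q ∣ n`: then `q ∣ x`, `q ∣ a`; divide once by `q`
    have hqx : (q : ℤ) ∣ x := by
      have : (q : ℤ) ∣ x ^ 2 := by
        have e : x ^ 2 = n + m * y ^ 2 := by linear_combination hrep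
        rw [e]; exact dvd_add hqn (dvd_mul_of_dvd_left hqm _)
      exact hqZ.dvd_of_dvd_pow this
    have hqy : ¬ (q : ℤ) ∣ y := fun h => hqZ.not_unit (hxy.isUnit_of_dvd' hqx h)
    have hqa : (q : ℤ) ∣ a := by
      have : (q : ℤ) ∣ a ^ 2 := by
        have e : a ^ 2 = v * n + m * b ^ 2 := by linear_combination -hvn
        rw [e]; exact dvd_add (dvd_mul_of_dvd_right hqn _) (dvd_mul_of_dvd_left hqm _)
      exact hqZ.dvd_of_dvd_pow this
    obtain ⟨m', hm'⟩ := hqm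
    obtain ⟨x', hx'⟩ := hqx
    obtain ⟨a', ha'⟩ := hqa
    have hqm' : ¬ (q : ℤ) ∣ m' := by
      rintro ⟨t, ht⟩
      have : (q : ℤ) * q ∣ m := ⟨t, by rw [hm', ht]; ring⟩
      exact hqZ.not_unit (hsq q this)
    have hq0 : (q : ℤ) ≠ 0 := by exact_mod_cast hq.out.ne_zero
    -- n = q n', v n' = q a'² − m' b²  with n' = q x'² − m' y²
    have hvn' : v * (q * x' ^ 2 - m' * y ^ 2) = q * a' ^ 2 - m' * b ^ 2 := by
      apply mul_left_cancel₀ hq0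
      have e : (q : ℤ) * (v * (q * x' ^ 2 - m' * y ^ 2)) = v * n := by rw [← hrep, hm', hx']; ring
      rw [e, hvn, hm', ha']; ring
    have hy0 : ((y : ℤ) : ZMod q) ≠ 0 := fun h => hqy ((ZMod.intCast_zmod_eq_zero_iff_dvd y q).1 h)
    have hm'0 : ((m' : ℤ) : ZMod q) ≠ 0 := fun h => hqm' ((ZMod.intCast_zmod_eq_zero_iff_dvd m' q).1 h)
    have e := congrArg (Int.cast : ℤ → ZMod q) hvn'
    push_cast at e
    rw [ZMod.natCast_self] at e
    have key : (v : ZMod q) * ((y : ZMod q) * y) = (b : ZMod q) * b := by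
      have e2 : ((m' : ℤ) : ZMod q) * ((v : ZMod q) * ((y : ZMod q) * y) - (b : ZMod q) * b) = 0 := by
        linear_combination -e
      rcases mul_eq_zero.1 e2 with h | h
      · exact absurd h hm'0
      · exact sub_eq_zero.1 h
    refine ⟨(b : ZMod q) * (y : ZMod q)⁻¹, ?_⟩
    have hyinv : (y : ZMod q) * (y : ZMod q)⁻¹ = 1 := mul_inv_cancel₀ hy0
    calc (v : ZMod q) = (v : ZMod q) * ((y : ZMod q) * y) * ((y : ZMod q)⁻¹ * (y : ZMod q)⁻¹) := by
          linear_combination (-(v : ZMod q) * ((y : ZMod q) * (y : ZMod q)⁻¹) - v) * hyinv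
      _ = (b : ZMod q) * b * ((y : ZMod q)⁻¹ * (y : ZMod q)⁻¹) := by rw [key]
      _ = (b : ZMod q) * (y : ZMod q)⁻¹ * ((b : ZMod q) * (y : ZMod q)⁻¹) := by ring
  · -- `q ∤ n`: `n ≡ x²`, `v n ≡ a²`
    have hqx : ¬ (q : ℤ) ∣ x := by
      intro hqx; apply hqn
      have e : n = x ^ 2 - m * y ^ 2 := hrep.symm
      rw [e]; exact dvd_sub (dvd_pow hqx two_ne_zero) (dvd_mul_of_dvd_left hqm _)
    have hx0 : ((x : ℤ) : ZMod q) ≠ 0 := fun h => hqx ((ZMod.intCast_zmod_eq_zero_iff_dvd x q).1 h)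
    have e1 := congrArg (Int.cast : ℤ → ZMod q) hrep
    have e2 := congrArg (Int.cast : ℤ → ZMod q) hvn
    push_cast at e1 e2
    rw [hm0] at e1 e2
    -- e1 : x^2 − 0·y^2 = n ; e2 : v n = a^2 − 0·b^2
    have key : (v : ZMod q) * ((x : ZMod q) * x) = (a : ZMod q) * a := by
      linear_combination e2 + (v : ZMod q) * e1
    refine ⟨(a : ZMod q) * (x : ZMod q)⁻¹, ?_⟩
    have hxinv : (x : ZMod q) * (x : ZMod q)⁻¹ = 1 := mul_inv_cancel₀ hx0
    calc (v : ZMod q) = (v : ZMod q) * ((x : ZMod q) * x) * ((x : ZMod q)⁻¹ * (x : ZMod q)⁻¹) := by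
          linear_combination (-(v : ZMod q) * ((x : ZMod q) * (x : ZMod q)⁻¹) - v) * hxinv
      _ = (a : ZMod q) * a * ((x : ZMod q)⁻¹ * (x : ZMod q)⁻¹) := by rw [key]
      _ = (a : ZMod q) * (x : ZMod q)⁻¹ * ((a : ZMod q) * (x : ZMod q)⁻¹) := by ring

/-- Hence the Legendre symbol `(v∕q) = +1`. -/
theorem legendreSym_value_eq_one {m n v x y a b : ℤ} {q : ℕ} [Fact q.Prime] (hsq : Squarefree m) (hqm : (q : ℤ) ∣ m)
    (hrep : x ^ 2 - m * y ^ 2 = n) (hxy : IsCoprime x y) (hvn : v * n = a ^ 2 - m * b ^ 2) (hqv : ¬ (q : ℤ) ∣ v) :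
    legendreSym q v = 1 := by
  obtain ⟨hsqv, hv0⟩ := isSquare_value hsq hqm hrep hxy hvn hqv
  exact (legendreSym.eq_one_iff q hv0).2 hsqv

/-- **For `m ≡ 1 (mod 4)`, `m < 0`, the assigned characters of `4m` are the `χ_q` over the odd primes `q ∣ m` only** (Cox's table:
`|4m|∕4 = −m ≡ 3 (mod 4)`). -/
theorem assignedChars_four_mul {m : ℤ} (hm : m < 0) (hm4 : m % 4 = 1) :
    assignedChars (4 * m) = ((4 * m).natAbs.primeFactors.erase 2).image legendre := by
  have h1 : ¬ (4 * m) % 4 = 1 := by omega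
  have h2 : (4 * m).natAbs / 4 % 4 = 3 := by omega
  unfold assignedChars
  rw [if_neg h1, if_pos h2]

/-- A value `v = f(x₀, y₀)` of the form `(n, 2A, k)` satisfies `v · n = (n x₀ + A y₀)² − m y₀²`. -/
theorem eval_mul_n {m n k A x₀ y₀ : ℤ} (hk : A ^ 2 - n * k = m) :
    (⟨n, 2 * A, k⟩ : BinQF).eval x₀ y₀ * n = (n * x₀ + A * y₀) ^ 2 - m * y₀ ^ 2 := by
  simp only [BinQF.eval]; linear_combination (-(y₀ ^ 2)) * hk

/-- **THE GENERAL CAPTURE for `m ≡ 1 (mod 4)`, one class per genus stated on forms.**  `m < 0` squarefree, `m ≡ 1 (mod 4)`; any two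
primitive positive definite forms of discriminant `4m` in the same genus are properly equivalent (Cox Thm 3.22 (i)); `n = x² − m y² > 0`
with `x, y` coprime; `A² − n k = m`; the form `(n, 2A, k)` primitive.  Then some primitive `z ∈ ℤ√m` with `N z = n` divides `A − √m`.
Route: a value `v` of the form prime to `4m` exists (Cox Lemma 2.25, tree); every assigned character is a `χ_q`, `q ∣ m` odd, and
`χ_q(v) = 1` (`legendreSym_value_eq_one`); so the form is in the principal genus (tree: `mem_principalValues_iff_completeChar_eq_one`),
properly equivalent to the principal form, its ideal class is trivial (Cox Thm 7.7 (ii), tree), `𝔞_n(A) = (n, −A + √m)` is principal,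
and the §11 PROPOSITION (315) gives `z`.  Covers the coprime (315 `capture`), ramified (331) and EVEN-weight (THEOREM A′, new) cases alike. -/
theorem capture_one_mod_four_of_forall_genus {m : ℤ} (hm : m < 0) (hm4 : m % 4 = 1) (hsq : Squarefree m)
    (H : ∀ f g : BinQF, f.IsPosPrim (4 * m) → g.IsPosPrim (4 * m) → f.genus (4 * m) = g.genus (4 * m) → f.ProperEquiv g)
    {n k A x y : ℤ} (hn : 0 < n) (hk : A ^ 2 - n * k = m) (hrep : x ^ 2 - m * y ^ 2 = n) (hxy : IsCoprime x y)
    (hprim : ∀ d : ℤ, d ∣ n → d ∣ 2 * A → d ∣ k → IsUnit d) :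
    ∃ z : ℤ√m, z.norm = n ∧ z ∣ (⟨A, -1⟩ : ℤ√m) ∧ IsCoprime z.re z.im := by
  haveI : IsDomain (ℤ√m) := Zsqrtd.isDomain_of_neg hm
  have hD : 4 * m < 0 := by omega
  have hD4 : (4 * m) % 4 = 0 ∨ (4 * m) % 4 = 1 := Or.inl (by omega)
  set f : BinQF := ⟨n, 2 * A, k⟩ with hfdef
  have hf : f.IsPosPrim (4 * m) := lineForm_isPosPrim_of_primitive hn hk hprim
  -- a value of `f` prime to `4m`
  obtain ⟨x₀, y₀, -, hv⟩ := BinQF.exists_eval_isCoprime hf.primitive (M := 4 * m) (by omega)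
  set v : ℤ := f.eval x₀ y₀ with hvdef
  have hvn : v * n = (n * x₀ + A * y₀) ^ 2 - m * y₀ ^ 2 := eval_mul_n hk
  let u : (ZMod (4 * m).natAbs)ˣ := unitOfIsCoprime hv
  have hcoe : (u : ZMod (4 * m).natAbs) = (v : ZMod (4 * m).natAbs) := rfl
  have hu : u ∈ f.valueSet (4 * m) := ⟨x₀, y₀, hcoe.symm⟩
  -- every assigned character of `4m` is `+1` at `v`
  have hchar : completeChar (4 * m) u = 1 := by
    funext c
    rw [completeChar_apply]
    have hc : c.1 ∈ ((4 * m).natAbs.primeFactors.erase 2).image legendre := by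
      rw [← assignedChars_four_mul hm hm4]; exact c.2
    simp only [Finset.mem_image, Finset.mem_erase, Nat.mem_primeFactors] at hc
    obtain ⟨p, ⟨hp2, hp, hpd, -⟩, hcp⟩ := hc
    haveI : Fact p.Prime := ⟨hp⟩
    have hpZ : Prime (p : ℤ) := Nat.prime_iff_prime_int.1 hp
    have hpm : (p : ℤ) ∣ m := by
      have h4 : (p : ℤ) ∣ 4 * m := Int.natCast_dvd.2 hpd
      rcases hpZ.dvd_or_dvd h4 with h | h
      · exfalso
        have h22 : (p : ℤ) ∣ 2 * 2 := by norm_num; exact h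
        have h2 : (p : ℤ) ∣ 2 := (hpZ.dvd_or_dvd h22).elim id id
        have h2' : p ∣ 2 := by exact_mod_cast h2
        exact hp2 ((Nat.prime_dvd_prime_iff_eq hp Nat.prime_two).1 h2')
      · exact h
    have hpv : ¬ (p : ℤ) ∣ v := fun h => hpZ.not_unit (hv.isUnit_of_dvd' h (dvd_mul_of_dvd_right hpm 4))
    have hleg : legendreSym p v = 1 := legendreSym_value_eq_one hsq hpm hrep hxy hvn hpv
    show (c.1).unitHom (4 * m).natAbs u = 1
    apply Units.val_eq_one.1
    rw [← hcp, coe_unitHom_legendre hpd hcoe.symm, hleg]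
  -- so `f` is in the principal genus
  let Δ : NegDiscr := ⟨4 * m, hD⟩
  have hmem : u ∈ principalValues (4 * m) := (mem_principalValues_iff_completeChar_eq_one Δ hD4).2 hchar
  have hgen : f.genus (4 * m) = (one (4 * m)).genus (4 * m) := by
    rw [BinQF.genus_eq_mk hD hf hu, genus_one hD hD4]
    exact (QuotientGroup.eq_one_iff u).2 hmem
  -- properly equivalent to the principal form ⇒ trivial class ⇒ principal ideal ⇒ §11 PROPOSITION
  have hpe : f.ProperEquiv (one (4 * m)) := H _ _ hf (isPosPrim_one hD hD4).1 hgen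
  have hcl : BinQF.toClass m f = 1 := by
    rw [BinQF.toClass_eq_of_properEquiv hm hf hpe, one_four_mul_eq_principalForm, BinQF.toClass_principalForm]
  have hunit := BinQF.isUnit_fracIdeal_of_isPosPrim hf
  rw [BinQF.toClass_of_isUnit hunit] at hcl
  have hP := ClassGroup.mk_eq_one_iff.1 hcl
  rw [hunit.unit_spec] at hP
  obtain ⟨z, hz⟩ := exists_span_singleton_of_coe_isPrincipal (K := FractionRing (ℤ√m)) (BinQF.ideal m f) hP
  rw [hfdef, ideal_lineForm] at hz
  obtain ⟨hdvd, hnorm⟩ := dvd_and_norm_of_span_eq hn.ne' hk hz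
  have h0 := Zsqrtd.norm_nonneg hm.le z
  refine ⟨z, ?_, hdvd, ?_⟩
  · rcases hnorm with h | h
    · exact h
    · omega
  · obtain ⟨w, hw⟩ := hdvd
    exact isCoprime_of_dvd hw.symm

/-- **THE GENERAL CAPTURE under the printed class-number criterion** `h(4m) = 2^{μ−1}` (one class per genus, Cox Thm 3.22 (v)),
for `m < 0` squarefree, `m ≡ 1 (mod 4)`: every `n = x² − m y² > 0` (`x, y` coprime) with `A² − n k = m` and `(n, 2A, k)` primitive is
captured at `A` — in particular the EVEN weights of THEOREM A′ (conductor-2 case), where primitivity of `(n, 2A, k)` is the 2-ADIC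
RULE «`k = (A² − m)∕n` odd» (PROPOSITION 2), and the odd ramified weights.  [LINE-LAW-THEOREMS-B.md §8 (i), first half.] -/
theorem capture_one_mod_four {m : ℤ} (hm : m < 0) (hm4 : m % 4 = 1) (hsq : Squarefree m)
    (hh : BinaryQuadraticForm.classNumber (4 * m) = 2 ^ (assignedCharCount (4 * m) - 1))
    {n k A x y : ℤ} (hn : 0 < n) (hk : A ^ 2 - n * k = m) (hrep : x ^ 2 - m * y ^ 2 = n) (hxy : IsCoprime x y)
    (hprim : ∀ d : ℤ, d ∣ n → d ∣ 2 * A → d ∣ k → IsUnit d) :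
    ∃ z : ℤ√m, z.norm = n ∧ z ∣ (⟨A, -1⟩ : ℤ√m) ∧ IsCoprime z.re z.im := by
  let Δ : NegDiscr := ⟨4 * m, by omega⟩
  have hD4 : Δ.D % 4 = 0 ∨ Δ.D % 4 = 1 := Or.inl (show (4 * m) % 4 = 0 by omega)
  have hsq1 := (forall_sq_eq_one_iff_classNumber_eq Δ hD4).2 hh
  exact capture_one_mod_four_of_forall_genus hm hm4 hsq
    ((forall_genus_eq_imp_properEquiv_iff_forall_sq_eq_one Δ hD4).2 hsq1) hn hk hrep hxy hprim

/-- **THEOREM A′ (sufficiency, one weight at a time) with the 2-ADIC RULE AS PRINTED**: for `m < 0` squarefree, `m ≡ 1 (mod 4)`,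
`h(4m) = 2^{μ−1}`: if `n = x² − m y² > 0` is a primitive norm, `A² − n k = m`, and `n` or `k` is odd (for even `n`: «the cofactor
`k = (A² − m)∕n` is odd», PROPOSITION 2's rule), then a primitive `z ∈ ℤ√m` with `N z = n` divides `A − √m`.  The common root `A`
serving all weights of a line at once (odd parts by CRT, STEP 1 of LINE-LAW-THEOREMS-B §3 for the 2-part) is an input here. -/
theorem capture_one_mod_four_of_parity {m : ℤ} (hm : m < 0) (hm4 : m % 4 = 1) (hsq : Squarefree m)
    (hh : BinaryQuadraticForm.classNumber (4 * m) = 2 ^ (assignedCharCount (4 * m) - 1))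
    {n k A x y : ℤ} (hn : 0 < n) (hk : A ^ 2 - n * k = m) (hrep : x ^ 2 - m * y ^ 2 = n) (hxy : IsCoprime x y)
    (h2 : Odd n ∨ Odd k) : ∃ z : ℤ√m, z.norm = n ∧ z ∣ (⟨A, -1⟩ : ℤ√m) ∧ IsCoprime z.re z.im :=
  capture_one_mod_four hm hm4 hsq hh hn hk hrep hxy (lineForm_primitive_of_squarefree hsq hk h2)

/-- **Instance: the even weight `16` over `ℤ[√−15]`** (`h(−60) = 2 = 2^{μ−1}`, `μ = 2`; LINE-LAW-THEOREMS §3's field list): `16 = 1 + 15`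
(`x = y = 1`), `A = 15`: `A² + 15 = 240 = 16·15`, `k = 15` odd, `(16, 30, 15)` primitive — the theorem's hypotheses in numbers
(the capture itself: `z = 1 + √−15`, `(15 − √−15)∕(1 + √−15) = −√−15`). -/
example : (1 : ℤ) ^ 2 - (-15) * 1 ^ 2 = 16 ∧ (15 : ℤ) ^ 2 - 16 * 15 = -15 ∧
    (⟨1, 1⟩ : ℤ√(-15)) * ⟨0, -1⟩ = ⟨15, -1⟩ := by
  refine ⟨by norm_num, by norm_num, by ext <;> simp⟩

end Summit.Ventures.HSemireg.LineLawGeneralCapture
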